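import Mathlib
import Summits.Ventures.PercRepro2.HCov
import Summits.Ventures.PercRepro2.HCovSwap
import Summits.Ventures.PercRepro2.ContractDefs
import Summits.Ventures.PercRepro2.HCovCubic
import Summits.Ventures.PercRepro2.RECMReduction
import Summits.Ventures.PercRepro2.RECMReductionC

/-!
# Transport of the covariance form: pinned closed = re-routed to a loop, pinned open = contracted
(blind cell PercRepro2, p1 g11; the identities behind the typed bridge of `CCWReduction.lean`)

At an edge `e` with weight `t = p e` the cleared covariance form `Gc` splits along its Bernstein
expansion in `t` (`hcov_cubic` + `triSum_pin` at `F = ∅`, **`Gc_split_edge`**):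

  `Gc(G) = (1 − t)³ · Gc(p[e ↦ 0]) + t³ · Gc(p[e ↦ 1]) + T₁ + T₂`,

`T_j = triSum p {e} (· ↦ j) K₃` the sums over the three-copy triples with exactly `j` copies open at
`e`. The two pinned terms are the DELETION and the CONTRACTION of `e` as graph operations on `ends`:

* **`Gc_update_zero_eq_loop`**: `Gc(p[e ↦ 0]) = Gc` (with the original weights) of the graph in
  which `e` is re-routed to a loop (`Function.update ends e s(v, v)`; one non-loop edge fewer,
  `nonLoopCard_update_loop_lt`);
* **`Gc_update_one_eq_contract`**: `Gc(p[e ↦ 1]) = Gc(G/e)` at a root edge `e = {a₁, y}` with `y`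
  unmarked (`contractRootEdge ends a₁ y`; one non-loop edge fewer, `nonLoopCard_contract_lt`).

Both are instances of one transport lemma, **`Gc_transport`**: a configuration map `Ψ` with
`P_q(A) = P_p(Ψ⁻¹ A)` for every event and a vertex map `φ` with
`Conn ends (Ψ ω) x z ↔ Conn ends' ω (φ x) (φ z)` carry `Gc q ends` to `Gc p ends'` on the images
(`expect_update_zero` / `expect_update_one` supply `Ψ = ω ↦ ω[e ↦ false / true]`;
`conn_update_false_iff_loop` and `conn_update_true_iff_contract` supply the connectivity
transport, the latter from the open-edge contraction identity `conn_contract_open_iff'`).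
-/

namespace Summit.Ventures.PercRepro2

open CovForm Contract

namespace RECM

/-! ## Transport of `Gc` along a configuration map and a vertex map -/

section Transport

variable {V : Type*} {E : Type*} [Fintype E] [DecidableEq E] [DecidableEq V] {R : Type*}
  [Field R] [LinearOrder R]

omit [Fintype E] [DecidableEq E] [DecidableEq V] in
/-- The preimage of a connection event under a configuration map transporting connectivity. -/
lemma preimage_connEvent {ends ends' : E → Sym2 V} {Ψ : Config E → Config E} {φ : V → V}
    (hH : ∀ ω x z, Conn ends (Ψ ω) x z ↔ Conn ends' ω (φ x) (φ z)) (x z : V) :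
    Ψ ⁻¹' connEvent ends x z = connEvent ends' (φ x) (φ z) := by
  ext ω
  simp [hH]

omit [Fintype E] [DecidableEq E] [DecidableEq V] in
/-- The preimage of a one-point avoidance event under a configuration map transporting
connectivity. -/
lemma preimage_avoidAll_singleton {ends ends' : E → Sym2 V} {Ψ : Config E → Config E} {φ : V → V}
    (hH : ∀ ω x z, Conn ends (Ψ ω) x z ↔ Conn ends' ω (φ x) (φ z)) (s x : V) :
    Ψ ⁻¹' avoidAll ends s {x} = avoidAll ends' (φ s) {φ x} := by
  ext ω
  simp [avoidAll, hH]

omit [Fintype E] [DecidableEq E] [DecidableEq V] in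
/-- The preimage of `PDEvent`. -/
lemma preimage_PDEvent {ends ends' : E → Sym2 V} {Ψ : Config E → Config E} {φ : V → V}
    (hH : ∀ ω x z, Conn ends (Ψ ω) x z ↔ Conn ends' ω (φ x) (φ z)) (a₁ a₂ a₃ : V) :
    Ψ ⁻¹' PDEvent ends a₁ a₂ a₃ = PDEvent ends' (φ a₁) (φ a₂) (φ a₃) := by
  simp only [PDEvent, Dtilde, UnionCluster.inU, Set.preimage_inter, Set.preimage_compl,
    Set.preimage_union, preimage_connEvent hH]

omit [Fintype E] [DecidableEq E] [DecidableEq V] in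
/-- The preimage of `TEvent`. -/
lemma preimage_TEvent {ends ends' : E → Sym2 V} {Ψ : Config E → Config E} {φ : V → V}
    (hH : ∀ ω x z, Conn ends (Ψ ω) x z ↔ Conn ends' ω (φ x) (φ z)) (a₁ a₂ a₃ : V) :
    Ψ ⁻¹' TEvent ends a₁ a₂ a₃ = TEvent ends' (φ a₁) (φ a₂) (φ a₃) := by
  simp only [TEvent, Set.preimage_inter, Set.preimage_compl, preimage_connEvent hH]

omit [DecidableEq V] [LinearOrder R] in
/-- **Transport of the covariance form**: if `P_q(A) = P_p(Ψ⁻¹ A)` for every event and `Ψ`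
carries `Conn ends` to `Conn ends'` along the vertex map `φ`, then `Gc` is carried along. -/
theorem Gc_transport {q p : E → R} {ends ends' : E → Sym2 V} {Ψ : Config E → Config E}
    {φ : V → V} (hP : ∀ A : Set (Config E), prob q A = prob p (Ψ ⁻¹' A))
    (hH : ∀ ω x z, Conn ends (Ψ ω) x z ↔ Conn ends' ω (φ x) (φ z)) (o a₁ a₂ a₃ b : V) :
    Gc q ends o a₁ a₂ a₃ b = Gc p ends' (φ o) (φ a₁) (φ a₂) (φ a₃) (φ b) := by
  simp only [Gc, DEF, EQbo, EQb3, EQb3o, EQo, EQ3, EQ3o, PDb, PDbo, Do, gap, hP,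
    Set.preimage_inter, preimage_PDEvent hH, preimage_TEvent hH, preimage_connEvent hH,
    preimage_avoidAll_singleton hH]

end Transport

/-! ## Pinned closed = the edge re-routed to a loop; pinned open = the edge contracted -/

section Pinned

variable {V : Type*} {E : Type*} [Fintype E] [DecidableEq E] {R : Type*} [CommRing R]

/-- Pinning `e` closed is the expectation of the observable with `e` forced closed. -/
lemma prob_update_zero_eq_preimage (p : E → R) (e : E) (A : Set (Config E)) :
    prob (Function.update p e 0) A = prob p ((fun ω => Function.update ω e false) ⁻¹' A) := by
  rw [prob_eq_expect_indicator, prob_eq_expect_indicator, expect_update_zero]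
  unfold expect
  refine Finset.sum_congr rfl fun ω _ => ?_
  by_cases h : Function.update ω e false ∈ A
  · have h' : ω ∈ (fun ω => Function.update ω e false) ⁻¹' A := h
    simp only [Set.indicator_of_mem h, Set.indicator_of_mem h', Pi.one_apply]
  · have h' : ω ∉ (fun ω => Function.update ω e false) ⁻¹' A := h
    simp only [Set.indicator_of_notMem h, Set.indicator_of_notMem h']

/-- Pinning `e` open is the expectation of the observable with `e` forced open. -/
lemma prob_update_one_eq_preimage (p : E → R) (e : E) (A : Set (Config E)) :
    prob (Function.update p e 1) A = prob p ((fun ω => Function.update ω e true) ⁻¹' A) := by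
  rw [prob_eq_expect_indicator, prob_eq_expect_indicator, expect_update_one]
  unfold expect
  refine Finset.sum_congr rfl fun ω _ => ?_
  by_cases h : Function.update ω e true ∈ A
  · have h' : ω ∈ (fun ω => Function.update ω e true) ⁻¹' A := h
    simp only [Set.indicator_of_mem h, Set.indicator_of_mem h', Pi.one_apply]
  · have h' : ω ∉ (fun ω => Function.update ω e true) ⁻¹' A := h
    simp only [Set.indicator_of_notMem h, Set.indicator_of_notMem h']

omit [Fintype E] in
/-- A loop edge is invisible to the open graph: its state may be changed freely. -/
lemma openGraph_update_of_isDiag (ends : E → Sym2 V) {e : E} (he : (ends e).IsDiag)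
    (ω : Config E) (c : Bool) : openGraph ends (Function.update ω e c) = openGraph ends ω := by
  ext u v
  simp only [openGraph_adj, OpenAdj]
  constructor
  · rintro ⟨huv, f, hf, hends⟩
    refine ⟨huv, f, ?_, hends⟩
    by_cases hfe : f = e
    · subst hfe
      exact absurd (hends ▸ he) (by rw [Sym2.mk_isDiag_iff]; exact huv)
    · rwa [Function.update_of_ne hfe] at hf
  · rintro ⟨huv, f, hf, hends⟩
    refine ⟨huv, f, ?_, hends⟩
    by_cases hfe : f = e
    · subst hfe
      exact absurd (hends ▸ he) (by rw [Sym2.mk_isDiag_iff]; exact huv)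
    · rwa [Function.update_of_ne hfe]

omit [Fintype E] in
/-- Connectivity ignores the state of a loop edge. -/
lemma conn_update_of_isDiag (ends : E → Sym2 V) {e : E} (he : (ends e).IsDiag) (ω : Config E)
    (c : Bool) (x z : V) : Conn ends (Function.update ω e c) x z ↔ Conn ends ω x z := by
  unfold Conn
  rw [openGraph_update_of_isDiag ends he ω c]

omit [Fintype E] in
/-- Forcing `e` closed is re-routing `e` to a loop: the open graphs coincide. -/
lemma openGraph_update_false_eq_loop (ends : E → Sym2 V) (e : E) (v : V) (ω : Config E) :
    openGraph ends (Function.update ω e false) = openGraph (Function.update ends e s(v, v)) ω := by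
  ext u w
  simp only [openGraph_adj, OpenAdj]
  constructor
  · rintro ⟨huw, f, hf, hends⟩
    by_cases hfe : f = e
    · subst hfe
      simp at hf
    · rw [Function.update_of_ne hfe] at hf
      exact ⟨huw, f, hf, by rw [Function.update_of_ne hfe]; exact hends⟩
  · rintro ⟨huw, f, hf, hends⟩
    by_cases hfe : f = e
    · subst hfe
      rw [Function.update_self, Sym2.eq_iff] at hends
      exact absurd (by rcases hends with ⟨h1, h2⟩ | ⟨h1, h2⟩ <;> rw [← h1, ← h2]) huw
    · rw [Function.update_of_ne hfe] at hends
      exact ⟨huw, f, by rw [Function.update_of_ne hfe]; exact hf, hends⟩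

omit [Fintype E] in
/-- Connectivity with `e` forced closed is connectivity with `e` re-routed to a loop. -/
lemma conn_update_false_iff_loop (ends : E → Sym2 V) (e : E) (v : V) (ω : Config E) (x z : V) :
    Conn ends (Function.update ω e false) x z ↔ Conn (Function.update ends e s(v, v)) ω x z := by
  unfold Conn
  rw [openGraph_update_false_eq_loop ends e v ω]

end Pinned

section Loop

variable {V : Type*} {E : Type*} [Fintype E] [DecidableEq E] [DecidableEq V] {R : Type*}
  [Field R] [LinearOrder R]

omit [DecidableEq V] [LinearOrder R] in
/-- **Pinned closed = re-routed to a loop**: `Gc(p[e ↦ 0])` is `Gc` (with the ORIGINAL weights) of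
the graph in which `e` has become the loop `s(v, v)`. -/
theorem Gc_update_zero_eq_loop (p : E → R) (ends : E → Sym2 V) (e : E) (v : V)
    (o a₁ a₂ a₃ b : V) :
    Gc (Function.update p e 0) ends o a₁ a₂ a₃ b =
      Gc p (Function.update ends e s(v, v)) o a₁ a₂ a₃ b :=
  Gc_transport (φ := id) (prob_update_zero_eq_preimage p e)
    (fun ω x z => conn_update_false_iff_loop ends e v ω x z) o a₁ a₂ a₃ b

/-- Re-routing a non-loop edge to a loop lowers the number of non-loop edges. -/
lemma nonLoopCard_update_loop_lt (ends : E → Sym2 V) {e : E}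
    (he : ¬ (ends e).IsDiag) (v : V) :
    nonLoopCard (Function.update ends e s(v, v)) < nonLoopCard ends := by
  unfold nonLoopCard
  apply Finset.card_lt_card
  have hsub : (Finset.univ.filter fun f => ¬ (Function.update ends e s(v, v) f).IsDiag) ⊆
      Finset.univ.filter fun f => ¬ (ends f).IsDiag := by
    intro f hf
    simp only [Finset.mem_filter, Finset.mem_univ, true_and] at hf ⊢
    by_cases hfe : f = e
    · subst hfe
      exact absurd (by simp) hf
    · rwa [Function.update_of_ne hfe] at hf
  rw [Finset.ssubset_iff_of_subset hsub]
  refine ⟨e, ?_, ?_⟩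
  · simp only [Finset.mem_filter, Finset.mem_univ, true_and]
    exact he
  · simp

end Loop

section Contract

variable {V : Type*} {E : Type*} [DecidableEq V]

omit [DecidableEq V] in
/-- With the edge `e = {a₁, y}` open, the two ends of `e` are connected. -/
lemma conn_ends_of_open {ends : E → Sym2 V} {ω : Config E} {e : E} {a₁ y : V}
    (hg : ends e = s(a₁, y)) (hω : ω e = true) : Conn ends ω a₁ y :=
  conn_of_openAdj ⟨e, hω, hg⟩

/-- With `e = {a₁, y}` open, two vertices with the same image under the contraction of `{a₁, y}`
are connected. -/
lemma conn_of_contractMap_eq {ends : E → Sym2 V} {ω : Config E} {e : E} {a₁ y : V}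
    (hg : ends e = s(a₁, y)) (hω : ω e = true) {u v : V}
    (h : contractMap {a₁, y} a₁ u = contractMap {a₁, y} a₁ v) : Conn ends ω u v := by
  have hay : Conn ends ω a₁ y := conn_ends_of_open hg hω
  by_cases hu : u ∈ ({a₁, y} : Finset V) <;> by_cases hv : v ∈ ({a₁, y} : Finset V)
  · simp only [Finset.mem_insert, Finset.mem_singleton] at hu hv
    rcases hu with rfl | rfl <;> rcases hv with rfl | rfl
    · exact conn_refl _ _ _
    · exact hay
    · exact conn_symm hay
    · exact conn_refl _ _ _
  · rw [contractMap_of_mem hu, contractMap_of_notMem hv] at h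
    exact absurd (h ▸ Finset.mem_insert_self a₁ {y}) hv
  · rw [contractMap_of_notMem hu, contractMap_of_mem hv] at h
    exact absurd (h.symm ▸ Finset.mem_insert_self a₁ {y}) hu
  · rw [contractMap_of_notMem hu, contractMap_of_notMem hv] at h
    rw [h]
    exact conn_refl _ _ _

/-- **Connections with `e = {a₁, y}` open are connections of `G/e` between the images** (the
open-edge contraction identity; cf. `Contract.conn_contract_iff` for vertices off `{a₁, y}`). -/
theorem conn_contract_open_iff' {ends : E → Sym2 V} {ω : Config E} {e : E} {a₁ y : V}
    (hg : ends e = s(a₁, y)) (hω : ω e = true) (x z : V) :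
    Conn ends ω x z ↔
      Conn (contractEnds ends {a₁, y} a₁) ω (contractMap {a₁, y} a₁ x) (contractMap {a₁, y} a₁ z) := by
  constructor
  · exact conn_contract_of_conn
  · intro h
    let S : Set V := {w' | ∀ w, contractMap {a₁, y} a₁ w = w' → Conn ends ω x w}
    have hx : contractMap {a₁, y} a₁ x ∈ S := fun w hw =>
      conn_symm (conn_of_contractMap_eq hg hω hw)
    have hS : ∀ z' ∈ S, ∀ z'', (openGraph (contractEnds ends {a₁, y} a₁) ω).Adj z' z'' → z'' ∈ S := by
      intro z' hz' z'' hadj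
      obtain ⟨_, f, hf, hends⟩ := openGraph_adj.1 hadj
      obtain ⟨u, v, huv⟩ : ∃ u v, ends f = s(u, v) :=
        (Sym2.exists (f := fun t => ends f = t)).1 ⟨ends f, rfl⟩
      rw [contractEnds_apply, huv, Sym2.map_mk, Sym2.eq_iff] at hends
      have huv' : Conn ends ω u v := conn_of_openAdj ⟨f, hf, huv⟩
      rcases hends with ⟨h1, h2⟩ | ⟨h1, h2⟩
      · intro w hw
        exact conn_trans (conn_trans (hz' u h1) huv')
          (conn_of_contractMap_eq hg hω (h2.trans hw.symm))
      · intro w hw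
        exact conn_trans (conn_trans (hz' v h2) (conn_symm huv'))
          (conn_of_contractMap_eq hg hω (h1.trans hw.symm))
    exact mem_of_conn_of_closed hS hx h z rfl

variable [Fintype E] [DecidableEq E]

omit [Fintype E] [DecidableEq E] in
/-- The contracted root edge is a loop. -/
lemma isDiag_contractRootEdge {ends : E → Sym2 V} {e : E} {a₁ y : V} (hg : ends e = s(a₁, y)) :
    (contractRootEdge ends a₁ y e).IsDiag := by
  rw [contractRootEdge, contractEnds_apply, hg, Sym2.map_mk, Sym2.mk_isDiag_iff,
    contractMap_of_mem (Finset.mem_insert_self a₁ {y}),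
    contractMap_of_mem (Finset.mem_insert_of_mem (Finset.mem_singleton_self y))]

omit [Fintype E] in
/-- Connectivity with `e = {a₁, y}` forced open is connectivity in `G/e` between the images. -/
lemma conn_update_true_iff_contract {ends : E → Sym2 V} {e : E} {a₁ y : V}
    (hg : ends e = s(a₁, y)) (ω : Config E) (x z : V) :
    Conn ends (Function.update ω e true) x z ↔
      Conn (contractRootEdge ends a₁ y) ω (contractMap {a₁, y} a₁ x) (contractMap {a₁, y} a₁ z) := by
  rw [conn_contract_open_iff' hg (by simp) x z]
  exact conn_update_of_isDiag _ (isDiag_contractRootEdge hg) ω true _ _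

variable {R : Type*} [Field R] [LinearOrder R]

omit [LinearOrder R] in
/-- **Pinned open = contracted**: `Gc(p[e ↦ 1]) = Gc(G/e)` at the root edge `e = {a₁, y}` with `y`
unmarked (the marks are fixed by the contraction map). -/
theorem Gc_update_one_eq_contract (p : E → R) {ends : E → Sym2 V} {e : E} {o a₁ a₂ a₃ b y : V}
    (hg : ends e = s(a₁, y)) (hy : Unmarked o a₁ a₂ a₃ b y) (ho1 : o ≠ a₁) (h12 : a₁ ≠ a₂)
    (h13 : a₁ ≠ a₃) (hb1 : b ≠ a₁) :
    Gc (Function.update p e 1) ends o a₁ a₂ a₃ b =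
      Gc p (contractRootEdge ends a₁ y) o a₁ a₂ a₃ b := by
  have key := Gc_transport (φ := contractMap {a₁, y} a₁) (prob_update_one_eq_preimage p e)
    (fun ω x z => conn_update_true_iff_contract hg ω x z) o a₁ a₂ a₃ b
  obtain ⟨hyo, hy1, hy2, hy3, hyb⟩ := hy
  have ho : o ∉ ({a₁, y} : Finset V) := by simp [ho1, hyo.symm]
  have h2 : a₂ ∉ ({a₁, y} : Finset V) := by simp [h12.symm, hy2.symm]
  have h3 : a₃ ∉ ({a₁, y} : Finset V) := by simp [h13.symm, hy3.symm]
  have hb : b ∉ ({a₁, y} : Finset V) := by simp [hb1, hyb.symm]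
  rwa [contractMap_of_notMem ho, contractMap_of_mem (Finset.mem_insert_self a₁ {y}),
    contractMap_of_notMem h2, contractMap_of_notMem h3, contractMap_of_notMem hb] at key

end Contract
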